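import Literature.MathematicalPhysics.QuantumFieldTheory.Balaban1983to89.B5Composition116

/-!
# `Balaban1983to89.B6Eq2103` — T. Bałaban, *Propagators and renormalization transformations for lattice gauge theories.
# II*, Commun. Math. Phys. **96** (1984) 223–250 [Balaban1984PropagatorsII], Sect. C (2.103)–(2.104) p. 241: the averages
# of a gauge-transformed configuration at the two levels `j`, `j + 1`, PROVED on the torus carriers of paper I's (1.18)

statement-level skeleton of published theorems with citation tags; proofs where landed; nothing here is a claim about the Yang–Mills mass gap

PDF held: `paper:balaban1984-cmp96-propagators-rt-ii` (journal page = PDF page + 222); p. 241 [PDF 19] read AS AN IMAGE on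
the ×2 render `run/shared/lean/pub/pub-balaban/b2b-balaban-ref1/pages/1984-cmp96-propagators-rt-II/…-p019-x2.png`.

CITATION HEADER (lean-in-tree rule).  WHAT IS REPRODUCED: lit-balaban SKELETON row **B6.Eq2.103** ((2.103)–(2.104), until
now `typed-existing`: (2.103) only CITED in `…B6Hprime2101`, the constraint (2.104) eliminated in `…B6Elimination`); it
also gives the shape of the gauge-invariance hypothesis `hgauge` of `…B6Eq2144` (p22 gen 3, (2.145): *"gauge-invariant with
respect to gauge transformations given by λ satisfying Q′λ = 0"*).  Unit `lit-balaban-r03` (B6 reader/typer and fold owner,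
gen 3), PHASE 2 (G.1/G.2(b): typed-not-proved row of the seat's own block), HOME `run/shared/lean/pub/lit-balaban/`,
2026-08-21.  IMPORTS `…B5Composition116` (hence `…B5Block118`, `…B5Action121`): the typed block averages `QvOp` = «Q_k»
(paper I (1.18)), `QsOp` = «Q′_k» (paper I (1.20)), the gauge transformation `gaugeT` / gradient `GradOp` (paper I
(1.4)), the one-level law `QvOp_gaugeT` = paper I (1.20) «Q_kA^λ = Q_kA − ∂Q′_kλ», and the composition laws
`QvOp_comp_mulVec` / `QsOp_comp_mulVec` = paper I (1.16)–(1.17) «Q ∘ Q_{k−1} = Q_k» — all consumed BY NAME, nothing restated.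

PRINT (p. 241, verbatim).  *"The transformations given by λ = H′_jμ are the only ones leaving invariant the third and fourth
terms in the quadratic form. For the averages in the first two terms we have
(Q_jA^λ)(b) = (Q_jA)(b) − ((Q′_jλ)(b₊) − (Q′_jλ)(b₋)) = (Q_jA)(b) − (∂₁μ)(b)
(Q_{j+1}A^λ)(c) = (Q_{j+1}A)(c) − L⁻¹((Q′_{j+1}λ)(c₊) − (Q′_{j+1}λ)(c₋)) = (Q_{j+1}A)(c) − (∂^LQ′₁μ)(c), (2.103)
where the equality Q′_jλ = Q′_jH′_jμ = μ was used. Hence these terms are invariant if and only if ∂₁μ = 0 on Λ^c and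
∂^LQ′₁μ = 0 on Λ′. This is possible only if μ is constant on Λ^c and Q′₁μ is constant on Λ′ and the constants are equal.
But we have assumed that μ is orthogonal to constant functions, so the constant is equal to 0 and we have
μ = 0 on Λ^c, Q′₁μ = 0 on Λ′. (2.104) This matches our needs exactly because the unit lattice gauge functions ω
appearing in the integral (2.97) satisfy the above conditions."*; the *"first two terms"* are those of (2.97) p. 240:
*"−½a Σ_{b∈Λ^c} |(Q_jA)(b)|² − ½aL^{d−2} Σ_{c∈Λ′} |(Q_{j+1}A)(c)|²"*.

DICTIONARY (three nested tori, the scale-free typing of `…B5Block118`/`…B5Composition116`; print omits `ξ` and `□`).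
The `L`-lattice of `Λ′` = `Tor M`; the unit lattice (of `Λ`, `Λ^c`) = `Tor (fine L M)`; the `ξ = L^{−j}`-lattice =
`Tor (fine L^j (fine L M))`.  `Q_j` = `QvOp (L^j) (fine L M)` (weights `ξ^{d+1}`, (1.18)), `Q′_j` = `QsOp (L^j) (fine L M)`,
`Q₁`/`Q′₁` = `QvOp L M` / `QsOp L M` (weights `L^{−(d+1)}`/`L^{−d}`, paper I (1.11)), and **`Q_{j+1} := Q₁Q_j`,
`Q′_{j+1} := Q′₁Q′_j`** (paper I (1.17); `Qcomp_mulVec`/`Qpcomp_mulVec` identify them with `QvOp (L·L^j) M` /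
`QsOp (L·L^j) M` read in the `(L·L^j)`-coordinates, by `…B5Composition116`).  Gauge transformation on the `ξ`-lattice
`A^λ = A − ∂^ξλ`, `∂^ξ` with lattice factor `ξ⁻¹ = L^j` (`gaugeT … (L^j : ℂ)`); `∂₁ = GradOp (fine L M) 1` (unit lattice);
`∂^L = GradOp M L⁻¹` (`(∂^Lf)(c) = L⁻¹(f(c₊) − f(c₋))`).  Bonds `b = ⟨y, y + e_ν⟩ ↔ (y, ν)`.  The integers `L ≥ 1`,
`L^j` are kept as two arbitrary positive naturals `m` (outer) and `n` (inner).

WHAT IS PROVED (0 sorry, 0 new named facts; finite sums only).  `eq2103_j` — line 1 of (2.103) with `μ = Q′_jλ` named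
(= paper I (1.20) at level `j`); `avg_grad` — `Q₁(∂₁μ) = ∂^L(Q′₁μ)` (the averaged pure gauge, paper I (1.13));
**`eq2103_j1`** — line 2 of (2.103), first equality (`Q_{j+1}`, `Q′_{j+1}`, the factor `L⁻¹`); **`eq2103_j1'`** — its second
equality `= (Q_{j+1}A)(c) − (∂^LQ′₁μ)(c)`; `Qcomp_mulVec`/`Qpcomp_mulVec` — `Q₁Q_j`, `Q′₁Q′_j` ARE `Q_{j+1}`, `Q′_{j+1}`;
**`invariant_iff`** — *"these terms are invariant if and only if ∂₁μ = 0 on Λ^c and ∂^LQ′₁μ = 0 on Λ′"* for the two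
sums of (2.97) over arbitrary bond sets `E` (print: the bonds of `Λ^c`) and `K` (of `Λ′`) with positive weights;
**`invariant_of_2104`** — the direction used on p. 241: (2.104) (`μ = 0` on the sites of `Λ^c`, `Q′₁μ = 0` on the sites
of `Λ′`) ⇒ invariance, for bond sets whose bonds have both end-points in those site sets.
NOT HERE: the converse *"This is possible only if μ is constant on Λ^c …"* (a connectedness property of the particular
sets `Λ^c`, `Λ′` of (2.89), not of arbitrary `E`, `K`; the elimination of (2.104) is `…B6Elimination`), and `λ = H′_jμ`
itself (`…B6Hprime2101`, `…B6Eq295`): (2.103) holds for EVERY `λ` with `μ := Q′_jλ`, which is all the display asserts.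
-/

noncomputable section

open scoped BigOperators Matrix
open Finset

namespace Literature.MathematicalPhysics.QuantumFieldTheory.Balaban1983to89.B6Eq2103

open Literature.MathematicalPhysics.QuantumFieldTheory.Balaban1983to89.B5Prop11Plancherel
open Literature.MathematicalPhysics.QuantumFieldTheory.Balaban1983to89.B5Action121
open Literature.MathematicalPhysics.QuantumFieldTheory.Balaban1983to89.B5Block118
open Literature.MathematicalPhysics.QuantumFieldTheory.Balaban1983to89.B5Composition116

variable {d : ℕ} (m n : ℕ) [NeZero m] [NeZero n] (M : Fin d → ℕ) [hM : ∀ μ, NeZero (M μ)]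

/-! ## §1 Line 1 of (2.103): level `j` (fine lattice → unit lattice) -/

/-- **(2.103), line 1** p. 241: `(Q_jA^λ)(b) = (Q_jA)(b) − ((Q′_jλ)(b₊) − (Q′_jλ)(b₋)) = (Q_jA)(b) − (∂₁μ)(b)`,
*"where the equality Q′_jλ = … = μ was used"* — for every `λ` on the `ξ`-lattice and `μ := Q′_jλ` (unit-lattice bond
`b = ⟨y, y + e_ν⟩`; `A^λ = A − ∂^ξλ` with factor `ξ⁻¹ = L^j = n`; paper I (1.20) at level `j`).
[cite: Balaban1984PropagatorsII, (2.103) p.241] -/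
theorem eq2103_j (A : Tor (fine n (fine m M)) × Fin d → ℂ) (lam : Tor (fine n (fine m M)) → ℂ)
    (μ : Tor (fine m M) → ℂ) (hμ : μ = QsOp n (fine m M) *ᵥ lam) (y : Tor (fine m M)) (ν : Fin d) :
    (QvOp n (fine m M) *ᵥ gaugeT (fine n (fine m M)) (n : ℂ) A lam) (y, ν)
      = (QvOp n (fine m M) *ᵥ A) (y, ν) - (μ (y + unitVec (fine m M) ν) - μ y) ∧
    (QvOp n (fine m M) *ᵥ gaugeT (fine n (fine m M)) (n : ℂ) A lam) (y, ν)
      = (QvOp n (fine m M) *ᵥ A) (y, ν) - (GradOp (fine m M) 1 *ᵥ μ) (y, ν) := by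
  subst hμ
  refine ⟨QvOp_gaugeT n (fine m M) A lam y ν, ?_⟩
  rw [QvOp_gaugeT_eq, Pi.sub_apply]

/-! ## §2 The averaged pure gauge: `Q₁(∂₁μ) = ∂^L(Q′₁μ)` -/

/-- The gradient is homogeneous in its lattice factor: `GradOp c = c • GradOp 1`. [folklore] -/
private theorem GradOp_eq_smul {N : Fin d → ℕ} [∀ μ, NeZero (N μ)] (c : ℂ) (f : Tor N → ℂ) :
    GradOp N c *ᵥ f = c • (GradOp N 1 *ᵥ f) := by
  funext ⟨x, ν⟩
  simp only [GradOp_mulVec, sdiff_mulVec, Pi.smul_apply, smul_eq_mul, one_mul]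

/-- **The average of a pure gauge** (paper I (1.13) «B^λ_c = B_c − L⁻¹((Q′λ)(c₊) − (Q′λ)(c₋)) = B_c − (∂Q′λ)(c)»,
here for the unit-lattice gradient with factor `1` averaged to the `L`-lattice): `Q₁(∂₁μ) = ∂^L(Q′₁μ)`,
`∂^L = GradOp M L⁻¹`. [cite: Balaban1984PropagatorsII, (2.103) p.241] -/
theorem avg_grad (μ : Tor (fine m M) → ℂ) :
    QvOp m M *ᵥ (GradOp (fine m M) 1 *ᵥ μ) = GradOp M ((m : ℂ)⁻¹) *ᵥ (QsOp m M *ᵥ μ) := by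
  have hm : (m : ℂ) ≠ 0 := by exact_mod_cast NeZero.ne m
  have h0 := QvOp_gaugeT_eq m M 0 μ
  simp only [gaugeT, zero_sub, Matrix.mulVec_neg, Matrix.mulVec_zero, neg_inj] at h0
  -- h0 : Q₁ (∂^{(m)} μ) = ∂₁^{(M)} (Q′₁ μ), factor m on the left, 1 on the right
  have h1 : GradOp (fine m M) 1 *ᵥ μ = (m : ℂ)⁻¹ • (GradOp (fine m M) (m : ℂ) *ᵥ μ) := by
    rw [GradOp_eq_smul (m : ℂ), smul_smul, inv_mul_cancel₀ hm, one_smul]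
  rw [h1, Matrix.mulVec_smul, h0, ← GradOp_eq_smul]

/-! ## §3 Line 2 of (2.103): level `j + 1` (fine lattice → `L`-lattice), `Q_{j+1} = Q₁Q_j` -/

/-- **(2.103), line 2, first equality** p. 241: `(Q_{j+1}A^λ)(c) = (Q_{j+1}A)(c) − L⁻¹((Q′_{j+1}λ)(c₊) − (Q′_{j+1}λ)(c₋))`
with `Q_{j+1} = Q₁Q_j`, `Q′_{j+1} = Q′₁Q′_j` (paper I (1.17)), `c = ⟨z, z + Le_ν⟩` a bond of the `L`-lattice, the same
`A^λ = A − ∂^ξλ`. [cite: Balaban1984PropagatorsII, (2.103) p.241] -/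
theorem eq2103_j1 (A : Tor (fine n (fine m M)) × Fin d → ℂ) (lam : Tor (fine n (fine m M)) → ℂ) (z : Tor M)
    (ν : Fin d) :
    (QvOp m M *ᵥ (QvOp n (fine m M) *ᵥ gaugeT (fine n (fine m M)) (n : ℂ) A lam)) (z, ν)
      = (QvOp m M *ᵥ (QvOp n (fine m M) *ᵥ A)) (z, ν)
        - (m : ℂ)⁻¹ * ((QsOp m M *ᵥ (QsOp n (fine m M) *ᵥ lam)) (z + unitVec M ν)
            - (QsOp m M *ᵥ (QsOp n (fine m M) *ᵥ lam)) z) := by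
  rw [QvOp_gaugeT_eq, Matrix.mulVec_sub, Pi.sub_apply, avg_grad, GradOp_mulVec, sdiff_mulVec]

/-- **(2.103), line 2, second equality** p. 241: `… = (Q_{j+1}A)(c) − (∂^LQ′₁μ)(c)` with `μ = Q′_jλ`,
`∂^L = GradOp M L⁻¹`. [cite: Balaban1984PropagatorsII, (2.103) p.241] -/
theorem eq2103_j1' (A : Tor (fine n (fine m M)) × Fin d → ℂ) (lam : Tor (fine n (fine m M)) → ℂ)
    (μ : Tor (fine m M) → ℂ) (hμ : μ = QsOp n (fine m M) *ᵥ lam) (z : Tor M) (ν : Fin d) :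
    (QvOp m M *ᵥ (QvOp n (fine m M) *ᵥ gaugeT (fine n (fine m M)) (n : ℂ) A lam)) (z, ν)
      = (QvOp m M *ᵥ (QvOp n (fine m M) *ᵥ A)) (z, ν) - (GradOp M ((m : ℂ)⁻¹) *ᵥ (QsOp m M *ᵥ μ)) (z, ν) := by
  subst hμ
  rw [QvOp_gaugeT_eq, Matrix.mulVec_sub, Pi.sub_apply, avg_grad]

/-- `Q₁Q_j` IS `Q_{j+1}` (paper I (1.17), kernel-checked in `…B5Composition116`): the composed average of `A` equals the
`(L·L^j)`-average of `A` read in the `(L·L^j)`-coordinates of the fine torus (`sitesV`).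
[cite: Balaban1984PropagatorsII, (2.103) p.241] -/
theorem Qcomp_mulVec (A : Tor (fine n (fine m M)) × Fin d → ℂ) (z : Tor M) (ν : Fin d) :
    (QvOp m M *ᵥ (QvOp n (fine m M) *ᵥ A)) (z, ν) = (QvOp (m * n) M *ᵥ (A ∘ sitesV m n M)) (z, ν) := by
  have h := QvOp_comp_mulVec m n M (A ∘ sitesV m n M) z ν
  have hA : (A ∘ sitesV m n M) ∘ (sitesV m n M).symm = A := by
    funext i
    simp
  rw [hA] at h
  exact h

/-- `Q′₁Q′_j` IS `Q′_{j+1}` (scalar version, `sites`). [cite: Balaban1984PropagatorsII, (2.103) p.241] -/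
theorem Qpcomp_mulVec (lam : Tor (fine n (fine m M)) → ℂ) (z : Tor M) :
    (QsOp m M *ᵥ (QsOp n (fine m M) *ᵥ lam)) z = (QsOp (m * n) M *ᵥ (lam ∘ sites m n M)) z := by
  have h := QsOp_comp_mulVec m n M (lam ∘ sites m n M) z
  have hl : (lam ∘ sites m n M) ∘ (sites m n M).symm = lam := by
    funext i
    simp
  rw [hl] at h
  exact h

/-! ## §4 "Hence these terms are invariant if and only if ∂₁μ = 0 on Λ^c and ∂^LQ′₁μ = 0 on Λ′" -/

/-- **p. 241: "Hence these terms are invariant if and only if ∂₁μ = 0 on Λ^c and ∂^LQ′₁μ = 0 on Λ′"** — the terms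
being the first two of the quadratic form of (2.97) p. 240, `a Σ_{b∈Λ^c} |(Q_jA)(b)|² + a′ Σ_{c∈Λ′} |(Q_{j+1}A)(c)|²`
(print: `a′ = aL^{d−2}`, common factor `−½` dropped; here any weights `a, a′ > 0` and any bond sets `E` — print: the
bonds of `Λ^c` — and `K` — of `Λ′`), `μ = Q′_jλ`, "invariant" = for every configuration `A`.
[cite: Balaban1984PropagatorsII, (2.103)–(2.104) p.241] -/
theorem invariant_iff {a a' : ℝ} (ha : 0 < a) (ha' : 0 < a') (E : Finset (Tor (fine m M) × Fin d))
    (K : Finset (Tor M × Fin d)) (lam : Tor (fine n (fine m M)) → ℂ) (μ : Tor (fine m M) → ℂ)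
    (hμ : μ = QsOp n (fine m M) *ᵥ lam) :
    (∀ A : Tor (fine n (fine m M)) × Fin d → ℂ,
        a * ∑ b ∈ E, ‖(QvOp n (fine m M) *ᵥ gaugeT (fine n (fine m M)) (n : ℂ) A lam) b‖ ^ 2
          + a' * ∑ c ∈ K, ‖(QvOp m M *ᵥ (QvOp n (fine m M) *ᵥ gaugeT (fine n (fine m M)) (n : ℂ) A lam)) c‖ ^ 2
        = a * ∑ b ∈ E, ‖(QvOp n (fine m M) *ᵥ A) b‖ ^ 2
          + a' * ∑ c ∈ K, ‖(QvOp m M *ᵥ (QvOp n (fine m M) *ᵥ A)) c‖ ^ 2) ↔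
      (∀ b ∈ E, (GradOp (fine m M) 1 *ᵥ μ) b = 0) ∧ (∀ c ∈ K, (GradOp M ((m : ℂ)⁻¹) *ᵥ (QsOp m M *ᵥ μ)) c = 0) := by
  subst hμ
  have hj : QvOp n (fine m M) *ᵥ gaugeT (fine n (fine m M)) (n : ℂ) (0 : Tor (fine n (fine m M)) × Fin d → ℂ) lam
      = -(GradOp (fine m M) 1 *ᵥ (QsOp n (fine m M) *ᵥ lam)) := by
    rw [QvOp_gaugeT_eq, Matrix.mulVec_zero, zero_sub]
  have hj1 : QvOp m M *ᵥ (QvOp n (fine m M) *ᵥ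
      gaugeT (fine n (fine m M)) (n : ℂ) (0 : Tor (fine n (fine m M)) × Fin d → ℂ) lam)
      = -(GradOp M ((m : ℂ)⁻¹) *ᵥ (QsOp m M *ᵥ (QsOp n (fine m M) *ᵥ lam))) := by
    rw [hj, Matrix.mulVec_neg, avg_grad]
  constructor
  · intro h
    have h0 := h 0
    simp only [hj1] at h0
    simp only [hj, Matrix.mulVec_zero, Pi.zero_apply, norm_zero, ne_eq, OfNat.ofNat_ne_zero,
      not_false_eq_true, zero_pow, Finset.sum_const_zero, mul_zero, add_zero, Pi.neg_apply, norm_neg] at h0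
    have hE : a * ∑ b ∈ E, ‖(GradOp (fine m M) 1 *ᵥ (QsOp n (fine m M) *ᵥ lam)) b‖ ^ 2 = 0 := by
      have h1 : 0 ≤ a * ∑ b ∈ E, ‖(GradOp (fine m M) 1 *ᵥ (QsOp n (fine m M) *ᵥ lam)) b‖ ^ 2 :=
        mul_nonneg ha.le (Finset.sum_nonneg fun _ _ => by positivity)
      have h2 : 0 ≤ a' * ∑ c ∈ K, ‖(GradOp M ((m : ℂ)⁻¹) *ᵥ (QsOp m M *ᵥ (QsOp n (fine m M) *ᵥ lam))) c‖ ^ 2 :=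
        mul_nonneg ha'.le (Finset.sum_nonneg fun _ _ => by positivity)
      linarith
    have hK : a' * ∑ c ∈ K, ‖(GradOp M ((m : ℂ)⁻¹) *ᵥ (QsOp m M *ᵥ (QsOp n (fine m M) *ᵥ lam))) c‖ ^ 2 = 0 := by
      linarith
    rw [mul_eq_zero_iff_left ha.ne'] at hE
    rw [mul_eq_zero_iff_left ha'.ne'] at hK
    rw [Finset.sum_eq_zero_iff_of_nonneg (fun _ _ => by positivity)] at hE hK
    refine ⟨fun b hb => ?_, fun c hc => ?_⟩
    · have := hE b hb
      rwa [sq_eq_zero_iff, norm_eq_zero] at this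
    · have := hK c hc
      rwa [sq_eq_zero_iff, norm_eq_zero] at this
  · rintro ⟨hE, hK⟩ A
    congr 1
    · congr 1
      refine Finset.sum_congr rfl fun b hb => ?_
      rw [QvOp_gaugeT_eq, Pi.sub_apply, hE b hb, sub_zero]
    · congr 1
      refine Finset.sum_congr rfl fun c hc => ?_
      rw [QvOp_gaugeT_eq, Matrix.mulVec_sub, Pi.sub_apply, avg_grad, hK c hc, sub_zero]

/-- **(2.104) ⇒ invariance, the direction used on p. 241** (*"This matches our needs exactly because the unit lattice
gauge functions ω appearing in the integral (2.97) satisfy the above conditions"*): if `μ = 0` on a site set `S` (print: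
the sites of `Λ^c`) and `Q′₁μ = 0` on a site set `S′` (the sites of `Λ′`), then `∂₁μ = 0` on every unit bond with both
end-points in `S` and `∂^LQ′₁μ = 0` on every `L`-bond with both end-points in `S′`, hence the two terms are invariant for
such bond sets `E`, `K`. [cite: Balaban1984PropagatorsII, (2.104) p.241] -/
theorem invariant_of_2104 (a a' : ℝ) (E : Finset (Tor (fine m M) × Fin d)) (K : Finset (Tor M × Fin d))
    (S : Set (Tor (fine m M))) (S' : Set (Tor M))
    (hE : ∀ b ∈ E, b.1 ∈ S ∧ b.1 + unitVec (fine m M) b.2 ∈ S)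
    (hK : ∀ c ∈ K, c.1 ∈ S' ∧ c.1 + unitVec M c.2 ∈ S')
    (lam : Tor (fine n (fine m M)) → ℂ) (μ : Tor (fine m M) → ℂ) (hμ : μ = QsOp n (fine m M) *ᵥ lam)
    (h2104 : (∀ y ∈ S, μ y = 0) ∧ (∀ z ∈ S', (QsOp m M *ᵥ μ) z = 0)) (A : Tor (fine n (fine m M)) × Fin d → ℂ) :
    a * ∑ b ∈ E, ‖(QvOp n (fine m M) *ᵥ gaugeT (fine n (fine m M)) (n : ℂ) A lam) b‖ ^ 2
        + a' * ∑ c ∈ K, ‖(QvOp m M *ᵥ (QvOp n (fine m M) *ᵥ gaugeT (fine n (fine m M)) (n : ℂ) A lam)) c‖ ^ 2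
      = a * ∑ b ∈ E, ‖(QvOp n (fine m M) *ᵥ A) b‖ ^ 2
        + a' * ∑ c ∈ K, ‖(QvOp m M *ᵥ (QvOp n (fine m M) *ᵥ A)) c‖ ^ 2 := by
  subst hμ
  have hE0 : ∀ b ∈ E, (GradOp (fine m M) 1 *ᵥ (QsOp n (fine m M) *ᵥ lam)) b = 0 := by
    rintro ⟨y, ν⟩ hb
    obtain ⟨h1, h2⟩ := hE _ hb
    rw [GradOp_mulVec, sdiff_mulVec, h2104.1 _ h1, h2104.1 _ h2, sub_self, mul_zero]
  have hK0 : ∀ c ∈ K, (GradOp M ((m : ℂ)⁻¹) *ᵥ (QsOp m M *ᵥ (QsOp n (fine m M) *ᵥ lam))) c = 0 := by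
    rintro ⟨z, ν⟩ hc
    obtain ⟨h1, h2⟩ := hK _ hc
    rw [GradOp_mulVec, sdiff_mulVec, h2104.2 _ h1, h2104.2 _ h2, sub_self, mul_zero]
  congr 1
  · congr 1
    refine Finset.sum_congr rfl fun b hb => ?_
    rw [QvOp_gaugeT_eq, Pi.sub_apply, hE0 b hb, sub_zero]
  · congr 1
    refine Finset.sum_congr rfl fun c hc => ?_
    rw [QvOp_gaugeT_eq, Matrix.mulVec_sub, Pi.sub_apply, avg_grad, hK0 c hc, sub_zero]

end Literature.MathematicalPhysics.QuantumFieldTheory.Balaban1983to89.B6Eq2103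

end
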